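import Mathlib
import HarnessLib
import Literature.Algebra.EuclideanLattices.FccBccLattices
import Summits.AtomisticToContinuum.Crystallization.Theorems.PricedLinkCensusSoftLayerPropagationStubMetricDet
import Summits.AtomisticToContinuum.Crystallization.Theorems.PricedLinkCensusSoftLayerPropagationStubMetricSolve
import Summits.AtomisticToContinuum.Crystallization.Theorems.PricedLinkCensusSoftLayerPropagationStubMetricOcta
import Summits.AtomisticToContinuum.Crystallization.Theorems.PricedLinkCensusSoftLayerPropagationStubMetricScaled

/-!
# No common neighbour across a coned square except the far apex (crux `SoftLayerPropagation`, line `Sketch`)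

Route `PricedLinkCensus`, crux `SoftLayerPropagation` (stmt-AtomisticToContinuum-14233), line
`Sketch`, helper file for the stubs `develop_HX_fcc` / `develop_HX_hcp` (local no-merge): the metric
heart of the SQUARE-DIAGONAL case, registered sub-goal `hx_lens_square`.

**The lens lemma for a square diagonal (unit scale).**  Let `{x, z; u, k; a, b}` be a near-regular
contact octahedron (diagonal pairs `(u,k)`, `(a,b)`, `(x,z)`; the twelve squared edges in
`[1, 1 + 13/200]`, the three squared diagonals `≥ 1`) and `t` a further point with
`1 ≤ ‖t − u‖², ‖t − k‖² ≤ 1 + 13/200` (bonded to the diagonal pair `u, k`) and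
`‖t − x‖², ‖t − a‖², ‖t − b‖² ≥ 1`, `‖t − z‖² ≥ 49/50` (hard core against the four other vertices).
Then: contradiction.  (So a site bonded to two opposite corners of a coned square of the link of `x`
IS the far apex `z` — the no-merge statement `HX` in the square-diagonal case.)

Proof.  With `W = 2t − u − k` and the diagonals `n₁ = u − k`, `n₂ = a − b`, `n₃ = x − z`:
polarisation gives `⟪W, n₁⟫ = ‖t−k‖² − ‖t−u‖²` (tiny), and `⟪W, n₂⟫`, `⟪W, n₃⟫` equal to
`‖t−b‖² − ‖t−a‖²`, `‖t−z‖² − ‖t−x‖²` up to `13/200`; the octahedron lemma (`metric_octahedron`: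
diagonals `≈ √2`, nearly orthogonal, common centre) bounds `‖t−x‖² + ‖t−z‖²` and `‖t−a‖² + ‖t−b‖²`
by `2.72`, so with the hard cores all three `⟪W, nᵢ⟫` are at most `0.83` in size while
`‖W‖² ≥ 4 − 2.29`.  The product identity `det(W,n₂,n₃)·det(n₁,n₂,n₃) = det(⟪·,·⟫)` makes
`det(W,n₂,n₃)² ≤ 0.35`, whereas its Gram expansion is `≥ 2.65`: contradiction.  All `[folklore]`.
-/

noncomputable section

namespace Summit.AtomisticToContinuum.Crystallization.Theorems

open Literature.Geometry.DiscreteGeometry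

/-- **Product of two signed volumes** as the determinant of the matrix of inner products
(`det A · det B = det (A Bᵀ)`), written out for `ℝ³`. [folklore] -/
theorem det3_mul_det3 (a b c d e f : EuclideanSpace ℝ (Fin 3)) :
    Matrix.det ![WithLp.ofLp a, WithLp.ofLp b, WithLp.ofLp c] *
        Matrix.det ![WithLp.ofLp d, WithLp.ofLp e, WithLp.ofLp f] =
      inner ℝ a d * (inner ℝ b e * inner ℝ c f - inner ℝ b f * inner ℝ c e) -
        inner ℝ a e * (inner ℝ b d * inner ℝ c f - inner ℝ b f * inner ℝ c d) +
        inner ℝ a f * (inner ℝ b d * inner ℝ c e - inner ℝ b e * inner ℝ c d) := by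
  simp only [det3_eq, Literature.Algebra.EuclideanLattices.inner_fin_three]
  ring

/-- Polarisation bookkeeping for the lens lemma: the vector `W = (t − u) + (t − k)` against the three
diagonals `u − k`, `a − b`, `x − z`, and the two parallelogram identities locating `t` against the
centres of the diagonals `(x,z)` and `(a,b)`. [folklore] -/
theorem lensB_identities (u k a b x z t : EuclideanSpace ℝ (Fin 3)) :
    ‖t - u + (t - k)‖ ^ 2 = 2 * ‖t - u‖ ^ 2 + 2 * ‖t - k‖ ^ 2 - ‖u - k‖ ^ 2 ∧
    inner ℝ (t - u + (t - k)) (u - k) = ‖t - k‖ ^ 2 - ‖t - u‖ ^ 2 ∧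
    inner ℝ (t - u + (t - k)) (a - b) =
      (‖u - a‖ ^ 2 - ‖u - b‖ ^ 2 + ‖k - a‖ ^ 2 - ‖k - b‖ ^ 2) / 2 + (‖t - b‖ ^ 2 - ‖t - a‖ ^ 2) ∧
    inner ℝ (t - u + (t - k)) (x - z) =
      (‖x - u‖ ^ 2 - ‖z - u‖ ^ 2 + ‖x - k‖ ^ 2 - ‖z - k‖ ^ 2) / 2 + (‖t - z‖ ^ 2 - ‖t - x‖ ^ 2) ∧
    2 * (‖t - x‖ ^ 2 + ‖t - z‖ ^ 2) = ‖t - u + (t - k) + (u + k - (x + z))‖ ^ 2 + ‖x - z‖ ^ 2 ∧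
    2 * (‖t - a‖ ^ 2 + ‖t - b‖ ^ 2) = ‖t - u + (t - k) + (u + k - (a + b))‖ ^ 2 + ‖a - b‖ ^ 2 := by
  simp only [Literature.Algebra.EuclideanLattices.inner_fin_three,
    Literature.Algebra.EuclideanLattices.norm_sq_fin_three, PiLp.add_apply, PiLp.sub_apply]
  refine ⟨by ring, by ring, by ring, by ring, by ring, by ring⟩

set_option maxHeartbeats 800000 in
/-- **Registered sub-goal `hx_lens_square`: the lens lemma for a square diagonal, unit scale.**
Octahedron `{x, z; u, k; a, b}` with squared edges in `[1, 1 + 13/200]` and squared diagonals `≥ 1`;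
a point `t` with `‖t−u‖², ‖t−k‖² ∈ [1, 1 + 13/200]`, `‖t−x‖², ‖t−a‖², ‖t−b‖² ≥ 1` and
`‖t−z‖² ≥ 49/50` does not exist. [folklore] -/
theorem hx_lens_square : ∀ (u k a b x z t : EuclideanSpace ℝ (Fin 3)),
    1 ≤ ‖u - a‖ ^ 2 → ‖u - a‖ ^ 2 ≤ 1 + 13 / 200 → 1 ≤ ‖u - b‖ ^ 2 → ‖u - b‖ ^ 2 ≤ 1 + 13 / 200 →
    1 ≤ ‖k - a‖ ^ 2 → ‖k - a‖ ^ 2 ≤ 1 + 13 / 200 → 1 ≤ ‖k - b‖ ^ 2 → ‖k - b‖ ^ 2 ≤ 1 + 13 / 200 →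
    1 ≤ ‖a - x‖ ^ 2 → ‖a - x‖ ^ 2 ≤ 1 + 13 / 200 → 1 ≤ ‖a - z‖ ^ 2 → ‖a - z‖ ^ 2 ≤ 1 + 13 / 200 →
    1 ≤ ‖b - x‖ ^ 2 → ‖b - x‖ ^ 2 ≤ 1 + 13 / 200 → 1 ≤ ‖b - z‖ ^ 2 → ‖b - z‖ ^ 2 ≤ 1 + 13 / 200 →
    1 ≤ ‖x - u‖ ^ 2 → ‖x - u‖ ^ 2 ≤ 1 + 13 / 200 → 1 ≤ ‖x - k‖ ^ 2 → ‖x - k‖ ^ 2 ≤ 1 + 13 / 200 →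
    1 ≤ ‖z - u‖ ^ 2 → ‖z - u‖ ^ 2 ≤ 1 + 13 / 200 → 1 ≤ ‖z - k‖ ^ 2 → ‖z - k‖ ^ 2 ≤ 1 + 13 / 200 →
    1 ≤ ‖u - k‖ ^ 2 → 1 ≤ ‖a - b‖ ^ 2 → 1 ≤ ‖x - z‖ ^ 2 →
    1 ≤ ‖t - u‖ ^ 2 → ‖t - u‖ ^ 2 ≤ 1 + 13 / 200 → 1 ≤ ‖t - k‖ ^ 2 → ‖t - k‖ ^ 2 ≤ 1 + 13 / 200 →
    1 ≤ ‖t - x‖ ^ 2 → 1 ≤ ‖t - a‖ ^ 2 → 1 ≤ ‖t - b‖ ^ 2 → 49 / 50 ≤ ‖t - z‖ ^ 2 → False := by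
  intro u k a b x z t hua hua' hub hub' hka hka' hkb hkb' hax hax' haz haz' hbx hbx' hbz hbz'
    hxu hxu' hxk hxk' hzu hzu' hzk hzk' huk hab hxz htu htu' htk htk' htx hta htb htz
  -- a product bound (cf. `Literature.Analysis.FluidPDE.CompressibleEuler.abs_mul_le_of_le`)
  have abs_mul_le_of_abs_le : ∀ {a b A B : ℝ}, |a| ≤ A → |b| ≤ B → |a * b| ≤ A * B :=
    fun ha hb => by rw [abs_mul]; exact mul_le_mul ha hb (abs_nonneg _) ((abs_nonneg _).trans ha)
  -- the octahedron lemma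
  have hα : (0 : ℝ) ≤ 13 / 200 := by norm_num
  have hα' : (13 : ℝ) / 200 ≤ 1 / 10 := by norm_num
  obtain ⟨o1, -, o3, ⟨lo1, hi1⟩, ⟨lo2, hi2⟩, ⟨lo3, hi3⟩, i12, i23, i31⟩ := metric_octahedron (13 / 200) hα hα'
    u k a b x z hua hua' hub hub' hka hka' hkb hkb' hax hax' haz haz' hbx hbx' hbz hbz' hxu hxu' hxk hxk'
    hzu hzu' hzk hzk' huk hab hxz
  -- the identities
  obtain ⟨e1, e2, e3, e4, e5, e6⟩ := lensB_identities u k a b x z t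
  have epr := det3_mul_det3 (t - u + (t - k)) (a - b) (x - z) (u - k) (a - b) (x - z)
  have egW := det3_sq_eq_gram (t - u + (t - k)) (a - b) (x - z)
  have hdet := det3_sq_ge_of_inner_le hα (u - k) (a - b) (x - z) i12
    (by rw [real_inner_comm]; exact i31) i23
  rw [norm_sub_rev] at o3
  -- names
  generalize hW : t - u + (t - k) = W at *
  generalize hn₁ : u - k = n₁ at *
  generalize hn₂ : a - b = n₂ at *
  generalize hn₃ : x - z = n₃ at *
  generalize hΔ₃ : u + k - (x + z) = Δ₃ at *
  generalize hΔ₂ : u + k - (a + b) = Δ₂ at *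
  -- numerical ranges of the diagonals
  norm_num at lo1 hi1 lo2 hi2 lo3 hi3 o1 o3
  -- `‖W‖²`
  have W2lo : 17146 / 10000 ≤ ‖W‖ ^ 2 := by rw [e1]; linarith only [htu, htk, hi1]
  have W2hi : ‖W‖ ^ 2 ≤ 24344 / 10000 := by rw [e1]; linarith only [htu', htk', lo1]
  have Wle : ‖W‖ ≤ 8 / 5 := by
    have : ‖W‖ ^ 2 ≤ (8 / 5) ^ 2 := W2hi.trans (by norm_num)
    exact (pow_le_pow_iff_left₀ (norm_nonneg _) (by norm_num) two_ne_zero).1 this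
  -- the centre offsets
  have hΔ₃n : ‖Δ₃‖ ≤ 169 / 800 := by
    have : ‖Δ₃‖ ^ 2 ≤ (169 / 800) ^ 2 := o3.trans (by norm_num)
    exact (pow_le_pow_iff_left₀ (norm_nonneg _) (by norm_num) two_ne_zero).1 this
  have hΔ₂n : ‖Δ₂‖ ≤ 169 / 800 := by
    have : ‖Δ₂‖ ^ 2 ≤ (169 / 800) ^ 2 := o1.trans (by norm_num)
    exact (pow_le_pow_iff_left₀ (norm_nonneg _) (by norm_num) two_ne_zero).1 this
  -- `‖t−x‖² + ‖t−z‖²` and `‖t−a‖² + ‖t−b‖²`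
  have S3 : ‖t - x‖ ^ 2 + ‖t - z‖ ^ 2 ≤ 27202 / 10000 := by
    have h1 : ‖W + Δ₃‖ ≤ ‖W‖ + ‖Δ₃‖ := norm_add_le _ _
    have h2 : ‖W + Δ₃‖ ^ 2 ≤ (‖W‖ + ‖Δ₃‖) ^ 2 := pow_le_pow_left₀ (norm_nonneg _) h1 2
    have h3 : (‖W‖ + ‖Δ₃‖) ^ 2 ≤ 24344 / 10000 + 2 * (8 / 5) * (169 / 800) + (169 / 800) ^ 2 := by
      nlinarith only [W2hi, Wle, hΔ₃n, norm_nonneg W, norm_nonneg Δ₃]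
    linarith only [e5, h2, h3, hi3]
  have S2 : ‖t - a‖ ^ 2 + ‖t - b‖ ^ 2 ≤ 27202 / 10000 := by
    have h1 : ‖W + Δ₂‖ ≤ ‖W‖ + ‖Δ₂‖ := norm_add_le _ _
    have h2 : ‖W + Δ₂‖ ^ 2 ≤ (‖W‖ + ‖Δ₂‖) ^ 2 := pow_le_pow_left₀ (norm_nonneg _) h1 2
    have h3 : (‖W‖ + ‖Δ₂‖) ^ 2 ≤ 24344 / 10000 + 2 * (8 / 5) * (169 / 800) + (169 / 800) ^ 2 := by
      nlinarith only [W2hi, Wle, hΔ₂n, norm_nonneg W, norm_nonneg Δ₂]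
    linarith only [e6, h2, h3, hi2]
  -- the three inner products of `W` with the diagonals
  have c1 : |inner ℝ W n₁| ≤ 13 / 200 := by
    rw [e2]; exact abs_le.2 ⟨by linarith only [htu', htk], by linarith only [htu, htk']⟩
  have c2 : |inner ℝ W n₂| ≤ 7852 / 10000 := by
    rw [e3]
    exact abs_le.2 ⟨by linarith only [hua, hub', hka, hkb', htb, S2],
      by linarith only [hua', hub, hka', hkb, hta, S2]⟩
  have c3 : |inner ℝ W n₃| ≤ 8252 / 10000 := by
    rw [e4]
    exact abs_le.2 ⟨by linarith only [hxu, hzu', hxk, hzk', htz, S3],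
      by linarith only [hxu', hzu, hxk', hzk, htx, S3]⟩
  -- near-orthogonality and sizes of the diagonals
  have g23 : |inner ℝ n₂ n₃| ≤ 13 / 200 := i23
  have g31 : |inner ℝ n₃ n₁| ≤ 13 / 200 := i31
  have g21 : |inner ℝ n₂ n₁| ≤ 13 / 200 := by rw [real_inner_comm]; exact i12
  have g32 : |inner ℝ n₃ n₂| ≤ 13 / 200 := by rw [real_inner_comm]; exact i23
  have N2 : |‖n₂‖ ^ 2| ≤ 22854 / 10000 := by
    rw [abs_of_nonneg (sq_nonneg _)]; exact hi2.trans (by norm_num)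
  have N3 : |‖n₃‖ ^ 2| ≤ 22854 / 10000 := by
    rw [abs_of_nonneg (sq_nonneg _)]; exact hi3.trans (by norm_num)
  -- the product identity bounds `det(W,n₂,n₃)²`
  have Rle : |Matrix.det ![WithLp.ofLp W, WithLp.ofLp n₂, WithLp.ofLp n₃] *
      Matrix.det ![WithLp.ofLp n₁, WithLp.ofLp n₂, WithLp.ofLp n₃]| ≤ 5856 / 10000 := by
    rw [epr]
    have t1 : |inner ℝ W n₁ * (inner ℝ n₂ n₂ * inner ℝ n₃ n₃ - inner ℝ n₂ n₃ * inner ℝ n₃ n₂)| ≤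
        13 / 200 * (52231 / 10000) := by
      refine abs_mul_le_of_abs_le c1 (abs_le.2 ⟨?_, ?_⟩)
      · rw [real_inner_self_eq_norm_sq, real_inner_self_eq_norm_sq]
        have h := abs_le.1 (abs_mul_le_of_abs_le g23 g32)
        have h0 : 0 ≤ ‖n₂‖ ^ 2 * ‖n₃‖ ^ 2 := by positivity
        linarith only [h.2, h0]
      · rw [real_inner_self_eq_norm_sq, real_inner_self_eq_norm_sq]
        have h := abs_le.1 (abs_mul_le_of_abs_le N2 N3)
        have h' : inner ℝ n₂ n₃ * inner ℝ n₃ n₂ = inner ℝ n₂ n₃ ^ 2 := by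
          rw [real_inner_comm n₃ n₂]; ring
        rw [h']
        linarith only [h.2, sq_nonneg (inner ℝ n₂ n₃)]
    have t2 : |inner ℝ W n₂ * (inner ℝ n₂ n₁ * inner ℝ n₃ n₃ - inner ℝ n₂ n₃ * inner ℝ n₃ n₁)| ≤
        7852 / 10000 * (13 / 200 * (22854 / 10000) + 13 / 200 * (13 / 200)) := by
      refine abs_mul_le_of_abs_le c2 ((abs_sub _ _).trans (add_le_add ?_ ?_))
      · rw [real_inner_self_eq_norm_sq]; exact abs_mul_le_of_abs_le g21 N3
      · exact abs_mul_le_of_abs_le g23 g31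
    have t3 : |inner ℝ W n₃ * (inner ℝ n₂ n₁ * inner ℝ n₃ n₂ - inner ℝ n₂ n₂ * inner ℝ n₃ n₁)| ≤
        8252 / 10000 * (13 / 200 * (13 / 200) + 22854 / 10000 * (13 / 200)) := by
      refine abs_mul_le_of_abs_le c3 ((abs_sub _ _).trans (add_le_add ?_ ?_))
      · exact abs_mul_le_of_abs_le g21 g32
      · rw [real_inner_self_eq_norm_sq]; exact abs_mul_le_of_abs_le N2 g31
    have := (abs_add_le _ _).trans (add_le_add ((abs_sub _ _).trans (add_le_add t1 t2)) t3)
    refine this.trans ?_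
    norm_num
  have Rsq : (Matrix.det ![WithLp.ofLp W, WithLp.ofLp n₂, WithLp.ofLp n₃] *
      Matrix.det ![WithLp.ofLp n₁, WithLp.ofLp n₂, WithLp.ofLp n₃]) ^ 2 ≤ 343 / 1000 := by
    have h := abs_le.1 Rle
    nlinarith only [h]
  -- `det(n₁,n₂,n₃)²` is large
  have Dsq : 605 / 100 ≤ Matrix.det ![WithLp.ofLp n₁, WithLp.ofLp n₂, WithLp.ofLp n₃] ^ 2 := by
    have p12 : (18256 / 10000) ^ 2 ≤ ‖n₁‖ ^ 2 * ‖n₂‖ ^ 2 := by nlinarith only [lo1, lo2]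
    have p123 : (18256 / 10000 : ℝ) ^ 3 ≤ ‖n₁‖ ^ 2 * ‖n₂‖ ^ 2 * ‖n₃‖ ^ 2 := by
      nlinarith only [p12, lo3]
    nlinarith only [hdet, p123, hi1, hi2, hi3]
  -- the Gram expansion of `det(W,n₂,n₃)²` is large
  have Gge : 265 / 100 ≤ Matrix.det ![WithLp.ofLp W, WithLp.ofLp n₂, WithLp.ofLp n₃] ^ 2 := by
    rw [egW]
    have hc2 := abs_le.1 c2; have hc3 := abs_le.1 c3; have hg := abs_le.1 g23
    have q1 : 17146 / 10000 * (18256 / 10000) ^ 2 ≤ ‖W‖ ^ 2 * ‖n₂‖ ^ 2 * ‖n₃‖ ^ 2 := by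
      have p : (18256 / 10000) ^ 2 ≤ ‖n₂‖ ^ 2 * ‖n₃‖ ^ 2 := by nlinarith only [lo2, lo3]
      nlinarith only [p, W2lo]
    have q2 : -(7852 / 10000 * (8252 / 10000) * (13 / 200)) ≤
        inner ℝ W n₂ * inner ℝ W n₃ * inner ℝ n₂ n₃ := by
      have := abs_mul_le_of_abs_le (abs_mul_le_of_abs_le c2 c3) g23
      exact (abs_le.1 this).1
    have q3 : ‖W‖ ^ 2 * inner ℝ n₂ n₃ ^ 2 ≤ 24344 / 10000 * (13 / 200) ^ 2 := by
      have : inner ℝ n₂ n₃ ^ 2 ≤ (13 / 200) ^ 2 := by nlinarith only [hg]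
      nlinarith only [this, W2hi, sq_nonneg ‖W‖, sq_nonneg (inner ℝ n₂ n₃)]
    have q4 : ‖n₂‖ ^ 2 * inner ℝ W n₃ ^ 2 ≤ 22854 / 10000 * (8252 / 10000) ^ 2 := by
      have : inner ℝ W n₃ ^ 2 ≤ (8252 / 10000) ^ 2 := by nlinarith only [hc3]
      nlinarith only [this, hi2, sq_nonneg ‖n₂‖, sq_nonneg (inner ℝ W n₃)]
    have q5 : ‖n₃‖ ^ 2 * inner ℝ W n₂ ^ 2 ≤ 22854 / 10000 * (7852 / 10000) ^ 2 := by
      have : inner ℝ W n₂ ^ 2 ≤ (7852 / 10000) ^ 2 := by nlinarith only [hc2]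
      nlinarith only [this, hi3, sq_nonneg ‖n₃‖, sq_nonneg (inner ℝ W n₂)]
    rw [real_inner_self_eq_norm_sq] at *
    linarith only [q1, q2, q3, q4, q5]
  -- contradiction
  have key : Matrix.det ![WithLp.ofLp W, WithLp.ofLp n₂, WithLp.ofLp n₃] ^ 2 *
      Matrix.det ![WithLp.ofLp n₁, WithLp.ofLp n₂, WithLp.ofLp n₃] ^ 2 =
      (Matrix.det ![WithLp.ofLp W, WithLp.ofLp n₂, WithLp.ofLp n₃] *
        Matrix.det ![WithLp.ofLp n₁, WithLp.ofLp n₂, WithLp.ofLp n₃]) ^ 2 := by ring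
  have prod := mul_le_mul Gge Dsq (by norm_num) (sq_nonneg _)
  rw [key] at prod
  linarith only [prod, Rsq]

/-- The bond window at scale `ℓ` with `ε ≤ 1/32` gives the unit window `[1, 1 + 13/200]` after
rescaling by `ℓ⁻¹`. [folklore] -/
theorem window_rescale_13 {ℓ ε : ℝ} (hℓ : 0 < ℓ) (hε : 0 ≤ ε) (hε' : ε ≤ 1 / 32)
    {p q : EuclideanSpace ℝ (Fin 3)} (h₁ : ℓ ≤ dist p q) (h₂ : dist p q ≤ (1 + ε) * ℓ) :
    1 ≤ ‖ℓ⁻¹ • p - ℓ⁻¹ • q‖ ^ 2 ∧ ‖ℓ⁻¹ • p - ℓ⁻¹ • q‖ ^ 2 ≤ 1 + 13 / 200 := by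
  obtain ⟨h1, h2⟩ := window_rescale hℓ h₁ h₂
  exact ⟨h1, h2.trans (by nlinarith)⟩

/-- A soft floor `ℓ ≤ (101/100) · dist p q` gives `49/50 ≤ ‖ℓ⁻¹•p − ℓ⁻¹•q‖²`. [folklore] -/
theorem soft_floor_rescale {ℓ : ℝ} (hℓ : 0 < ℓ) {p q : EuclideanSpace ℝ (Fin 3)}
    (h₁ : ℓ ≤ 101 / 100 * dist p q) : 49 / 50 ≤ ‖ℓ⁻¹ • p - ℓ⁻¹ • q‖ ^ 2 := by
  rw [norm_inv_smul_sub_sq hℓ, le_div_iff₀ (by positivity : (0 : ℝ) < ℓ ^ 2)]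
  have h0 : 0 ≤ dist p q := dist_nonneg
  nlinarith

set_option maxHeartbeats 400000 in
/-- **The lens lemma for a square diagonal at scale `ℓ`, distance form.**  Octahedron
`{x, z; u, k; a, b}` with the twelve edges in `[ℓ, (1+ε)ℓ]` (`ε ≤ 1/32`) and the three diagonals
`≥ ℓ`; a point `t` with `dist t u, dist t k ∈ [ℓ, (1+ε)ℓ]`, `dist t x, dist t a, dist t b ≥ ℓ` and
`(101/100) · dist t z ≥ ℓ` does not exist. [folklore] -/
theorem hx_lens_square_dist : ∀ ε ℓ : ℝ, 0 ≤ ε → ε ≤ 1 / 32 → 0 < ℓ →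
    ∀ (u k a b x z t : EuclideanSpace ℝ (Fin 3)),
      ℓ ≤ dist u a → dist u a ≤ (1 + ε) * ℓ → ℓ ≤ dist u b → dist u b ≤ (1 + ε) * ℓ →
      ℓ ≤ dist k a → dist k a ≤ (1 + ε) * ℓ → ℓ ≤ dist k b → dist k b ≤ (1 + ε) * ℓ →
      ℓ ≤ dist a x → dist a x ≤ (1 + ε) * ℓ → ℓ ≤ dist a z → dist a z ≤ (1 + ε) * ℓ →
      ℓ ≤ dist b x → dist b x ≤ (1 + ε) * ℓ → ℓ ≤ dist b z → dist b z ≤ (1 + ε) * ℓ →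
      ℓ ≤ dist x u → dist x u ≤ (1 + ε) * ℓ → ℓ ≤ dist x k → dist x k ≤ (1 + ε) * ℓ →
      ℓ ≤ dist z u → dist z u ≤ (1 + ε) * ℓ → ℓ ≤ dist z k → dist z k ≤ (1 + ε) * ℓ →
      ℓ ≤ dist u k → ℓ ≤ dist a b → ℓ ≤ dist x z →
      ℓ ≤ dist t u → dist t u ≤ (1 + ε) * ℓ → ℓ ≤ dist t k → dist t k ≤ (1 + ε) * ℓ →
      ℓ ≤ dist t x → ℓ ≤ dist t a → ℓ ≤ dist t b → ℓ ≤ 101 / 100 * dist t z → False := by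
  intro ε ℓ hε hε' hℓ u k a b x z t hua hua' hub hub' hka hka' hkb hkb' hax hax' haz haz' hbx hbx'
    hbz hbz' hxu hxu' hxk hxk' hzu hzu' hzk hzk' huk hab hxz htu htu' htk htk' htx hta htb htz
  have W := fun {p q : EuclideanSpace ℝ (Fin 3)} (h₁ : ℓ ≤ dist p q) (h₂ : dist p q ≤ (1 + ε) * ℓ) =>
    window_rescale_13 hℓ hε hε' h₁ h₂
  have F := fun {p q : EuclideanSpace ℝ (Fin 3)} (h₁ : ℓ ≤ dist p q) => floor_rescale hℓ h₁
  exact hx_lens_square (ℓ⁻¹ • u) (ℓ⁻¹ • k) (ℓ⁻¹ • a) (ℓ⁻¹ • b) (ℓ⁻¹ • x) (ℓ⁻¹ • z) (ℓ⁻¹ • t)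
    (W hua hua').1 (W hua hua').2 (W hub hub').1 (W hub hub').2 (W hka hka').1 (W hka hka').2
    (W hkb hkb').1 (W hkb hkb').2 (W hax hax').1 (W hax hax').2 (W haz haz').1 (W haz haz').2
    (W hbx hbx').1 (W hbx hbx').2 (W hbz hbz').1 (W hbz hbz').2 (W hxu hxu').1 (W hxu hxu').2
    (W hxk hxk').1 (W hxk hxk').2 (W hzu hzu').1 (W hzu hzu').2 (W hzk hzk').1 (W hzk hzk').2
    (F huk) (F hab) (F hxz) (W htu htu').1 (W htu htu').2 (W htk htk').1 (W htk htk').2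
    (F htx) (F hta) (F htb) (soft_floor_rescale hℓ htz)

end Summit.AtomisticToContinuum.Crystallization.Theorems

end
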